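import Summits.CriticalPhenomena.PercolationContinuityZ3.Theorems.PercNearOneGluingNoHeavyLowerTailAPLVwTwoLoad
import HarnessLib

/-!
# `NoHeavyLowerTail` (stmt-CriticalPhenomena-4575) — the lower companion of the three-point family:
# `P(s↔u)·(P(s↔b) + P(u↔b, u↮s)) ≤ P(s↔u, s↔b)`, i.e. `κ ≥ max(p,π)·m`

Support file (prover prim-ineq-gen-8 gen 56; `--supports stmt-CriticalPhenomena-4575`; memo
run/shared/lean/prim/prim-ineq-gen-8/FINDING-gen56-CASCADE.md §0(6)).  No definitions, no named facts, no sorries.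

`μ = prodBernoulli w` on the pairs of a finite vertex type `V`; notation of the lineage: `p = μ(s↔u)`, `π = μ(s↔b)`,
`τ = μ(s↔u ∩ s↔b)`, `κ = τ − pπ ≥ 0` (Harris), `m = μ(u↔b ∩ (s↔u)ᶜ)` (ports joined off the apex cluster).  The theorem family of the lineage
bounds `κ` from ABOVE (`κ² ≤ Pκ + 3Pm`, `APL.threePoint_all`).  Here is the elementary LOWER bound
* **`harrisPlus_all`** — `μ(s↔u)·(μ(s↔b) + μ(u↔b ∩ (s↔u)ᶜ)) ≤ μ(s↔u ∩ s↔b)`, i.e. `τ ≥ p(π + m)`, i.e. **`κ ≥ p·m`** (and `κ ≥ π·m` by symmetry):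
  Harris for the increasing events `{s↔u}` and `{b ~ {s,u}} = {s↔b} ∪ {u↔b}`, whose intersection is `{s↔u ∩ s↔b}` and whose second member has
  probability `π + m` (`{s↔b} ⊔ ({u↔b} ∩ {s↔u}ᶜ)`).  Equality on stars centred at `s` and when `s = u`.
Together with the attachment bound `κ/m ≤ Θ/(1−Θ)` (cluster deletion) this brackets `κ/m` from both sides: `max(p,π) ≤ κ/m`. [this work]
-/

noncomputable section

namespace Summit.CriticalPhenomena.PercolationContinuityZ3.Theorems

namespace APL

open MeasureTheory Set Literature.Probability.Percolation Literature.Probability.LatticeModels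
open scoped Classical

variable {V : Type*} [Fintype V]

/-- **`κ ≥ p·m` on every finite weighted graph**: for all vertices `s, u, b`,
`μ(s↔u)·(μ(s↔b) + μ(u↔b ∩ (s↔u)ᶜ)) ≤ μ(s↔u ∩ s↔b)` — Harris for `{s↔u}` and `{s↔b} ∪ {u↔b}`. [this work] -/
theorem harrisPlus_all (w : Sym2 V → unitInterval) (s u b : V) :
    (prodBernoulli w).real (openConn s u : Set (BondConfig V)) *
        ((prodBernoulli w).real (openConn s b : Set (BondConfig V)) +
          (prodBernoulli w).real ((openConn u b : Set (BondConfig V)) ∩ (openConn s u : Set (BondConfig V))ᶜ)) ≤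
      (prodBernoulli w).real ((openConn s u : Set (BondConfig V)) ∩ (openConn s b : Set (BondConfig V))) := by
  set μ := prodBernoulli w with hμ
  set U : Set (BondConfig V) := openConn s u with hU
  set B : Set (BondConfig V) := openConn s b with hB
  set D : Set (BondConfig V) := (openConn u b : Set (BondConfig V)) ∩ (openConn s u : Set (BondConfig V))ᶜ with hD
  set W : Set (BondConfig V) := (openConn s b : Set (BondConfig V)) ∪ (openConn u b : Set (BondConfig V)) with hW
  -- `W = B ⊔ D`
  have hWBD : W = B ∪ D := by
    ext ω
    simp only [hW, hB, hD, mem_union, mem_inter_iff, mem_compl_iff]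
    constructor
    · rintro (h | h)
      · exact Or.inl h
      · by_cases hsu : ω ∈ (openConn s u : Set (BondConfig V))
        · exact Or.inl (SimpleGraph.Reachable.trans hsu h)
        · exact Or.inr ⟨h, hsu⟩
    · rintro (h | ⟨h, -⟩)
      · exact Or.inl h
      · exact Or.inr h
  have hdisj : Disjoint B D := by
    rw [Set.disjoint_left]
    intro ω hb hd
    exact hd.2 (SimpleGraph.Reachable.trans hb (SimpleGraph.Reachable.symm hd.1))
  have hWsum : μ.real W = μ.real B + μ.real D := by
    rw [hWBD]; exact measureReal_union hdisj MeasurableSet.of_discrete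
  -- `U ∩ W = U ∩ B`
  have hUW : U ∩ W = U ∩ B := by
    ext ω
    simp only [hU, hW, hB, mem_inter_iff, mem_union]
    constructor
    · rintro ⟨hu, h | h⟩
      · exact ⟨hu, h⟩
      · exact ⟨hu, SimpleGraph.Reachable.trans hu h⟩
    · rintro ⟨hu, h⟩
      exact ⟨hu, Or.inl h⟩
  -- Harris for `U` and `W`
  have hWup : IsUpperSet W := IsUpperSet.union (isUpperSet_openConn s b) (isUpperSet_openConn u b)
  have hH : μ.real U * μ.real W ≤ μ.real (U ∩ W) :=
    prodBernoulli_harris w (isUpperSet_openConn s u) hWup MeasurableSet.of_discrete MeasurableSet.of_discrete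
  rw [hWsum, hUW] at hH
  exact hH

/-- Covariance form: `μ(s↔u)·μ(u↔b ∩ (s↔u)ᶜ) ≤ μ(s↔u ∩ s↔b) − μ(s↔u)μ(s↔b)`, i.e. `p·m ≤ κ`. [this work] -/
theorem kappa_ge_p_mul_off (w : Sym2 V → unitInterval) (s u b : V) :
    (prodBernoulli w).real (openConn s u : Set (BondConfig V)) *
        (prodBernoulli w).real ((openConn u b : Set (BondConfig V)) ∩ (openConn s u : Set (BondConfig V))ᶜ) ≤
      (prodBernoulli w).real ((openConn s u : Set (BondConfig V)) ∩ (openConn s b : Set (BondConfig V))) -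
        (prodBernoulli w).real (openConn s u : Set (BondConfig V)) * (prodBernoulli w).real (openConn s b : Set (BondConfig V)) := by
  have h := harrisPlus_all w s u b
  rw [mul_add] at h
  linarith

end APL

end Summit.CriticalPhenomena.PercolationContinuityZ3.Theorems

end
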